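import Mathlib.Analysis.SpecialFunctions.Trigonometric.Bounds
import Mathlib.Analysis.Convex.SpecificFunctions.Deriv
import Mathlib.Algebra.BigOperators.Ring.Finset
import HarnessLib

/-!
# A weighted azimuth budget and the hollow-ball pair lemma (real-variable tools)
# (crux `NoReconstructionGain`, stmt-Ventures-19144, line `replication-exactness`, inside `stub_noCriminal`)

HONEST FRAMING. Part of the venture `Summits/Ventures/Crystal3D` (cell `crystal3d-full`), helper `--supports` the
crux `NoReconstructionGain` (stmt-Ventures-19144, route `route-Ventures-StickyWulffConstant`), lead wulff-p1 g24.
Real-variable TOOLS only (no geometry, no films): the two ingredients of the linearly weighted one-sided kissing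
bound `Σ_{u ∈ F, 0 ≤ u₂ ≤ √(2/3)} (1 − u₂/√(2/3)) ≤ 6` proved in the sequel `…NoReconstructionGainHollowLoad` (the
hollow-ball row of the `W = √(2/3)` windowed weighted-kissing certificate for `(111)` films).

* `azimuth_weighted_walk`, **`azimuth_weighted_budget`** — if the azimuths `t` of a finite family carry weights
  `f ≥ 0` with BOTH arcs between any two members at least the sum of their weights, then `Σ f ≤ π` (the walk from
  the least to the largest azimuth plus the wrap-around arc is `2π`; induction on the member of largest azimuth).
  A weighted form of the uniform walk `Literature.Geometry.DiscreteGeometry.arc_lower_bound` (Kertész series).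
* `cos_pi_div_three_sub_ge_chord`, `cos_pi_div_three_sub_ge_sqrt_three_half` — `cos (π/3 − (π/6)x)` is bounded
  below by its chord `1/2 + ((√3−1)/2)x` on `x ∈ [0,1]` (concavity) and by `√3/2` on `x ∈ [1,2]`.
* `hollowPair_poly_chord`, `hollowPair_poly_flat` — the two polynomial inequalities, with explicit non-negative
  decompositions, and **`hollowPair_cos_bound`**: for `a, b ∈ [0,1]`,
  `1/2 − (2/3)ab ≤ √(1 − (2/3)a²)·√(1 − (2/3)b²)·cos(π/3 − (π/6)(a+b))` — by the spherical law of cosines this says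
  that two `60°`-separated unit vectors at heights `a√(2/3)`, `b√(2/3)` differ in azimuth by at least
  `(π/6)(1−a) + (π/6)(1−b)`; equality at `(0,0)` (equatorial pair, `60°`) and `(0,1)` (equator–top pair, `30°`).

WHAT THIS IS NOT: nothing about packings or films is proved here; the crux and rung F-C1 are not moved.
-/

noncomputable section

namespace Summit.Ventures.Crystal3D.Theorems

open Finset Real


/-! ## 1. The weighted azimuth budget (pure bookkeeping on a finite set of reals) -/

/-- **The weighted walk.**  If `f a + f b ≤ t b − t a` whenever `a ≠ b` in `S` with `t a ≤ t b`, then for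
non-empty `S` there are `lo, hi ∈ S` carrying the least and the largest value of `t` with
`2 Σ_S f ≤ (t hi − t lo) + f lo + f hi` (walk `lo → ⋯ → hi` through `S` sorted by `t`; induction on the
element of largest `t`). -/
theorem azimuth_weighted_walk {ι : Type*} [DecidableEq ι] (t f : ι → ℝ) (S : Finset ι)
    (hgap : ∀ a ∈ S, ∀ b ∈ S, a ≠ b → t a ≤ t b → f a + f b ≤ t b - t a) (hS : S.Nonempty) :
    ∃ lo ∈ S, ∃ hi ∈ S, (∀ x ∈ S, t lo ≤ t x) ∧ (∀ x ∈ S, t x ≤ t hi) ∧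
      2 * ∑ x ∈ S, f x ≤ (t hi - t lo) + f lo + f hi := by
  revert hgap hS
  induction S using Finset.induction_on_max_value t with
  | empty => intro _ h; exact absurd h Finset.not_nonempty_empty
  | insert a s has hmax ih =>
    intro hgap _
    by_cases hs : s.Nonempty
    · have hgap' : ∀ x ∈ s, ∀ y ∈ s, x ≠ y → t x ≤ t y → f x + f y ≤ t y - t x :=
        fun x hx y hy => hgap x (mem_insert_of_mem hx) y (mem_insert_of_mem hy)
      obtain ⟨lo, hlo, hi, hhi, h1, h2, h3⟩ := ih hgap' hs
      refine ⟨lo, mem_insert_of_mem hlo, a, mem_insert_self a s, ?_, ?_, ?_⟩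
      · intro x hx
        rcases mem_insert.1 hx with rfl | hx
        · exact (h1 lo hlo).trans (hmax lo hlo)
        · exact h1 x hx
      · intro x hx
        rcases mem_insert.1 hx with rfl | hx
        · exact le_rfl
        · exact hmax x hx
      · have hne : hi ≠ a := fun h => has (h ▸ hhi)
        have hg := hgap hi (mem_insert_of_mem hhi) a (mem_insert_self a s) hne (hmax hi hhi)
        rw [sum_insert has]
        linarith
    · rw [not_nonempty_iff_eq_empty] at hs
      subst hs
      refine ⟨a, mem_insert_self a ∅, a, mem_insert_self a ∅, ?_, ?_, ?_⟩
      · intro x hx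
        rw [mem_insert] at hx
        rcases hx with rfl | hx
        · exact le_rfl
        · exact absurd hx (Finset.notMem_empty x)
      · intro x hx
        rw [mem_insert] at hx
        rcases hx with rfl | hx
        · exact le_rfl
        · exact absurd hx (Finset.notMem_empty x)
      · rw [sum_insert (Finset.notMem_empty a), sum_empty]
        linarith

/-- **The weighted azimuth budget.**  If every pair `a ≠ b` of `S` with `t a ≤ t b` satisfies BOTH
`f a + f b ≤ t b − t a` and `f a + f b ≤ 2π − (t b − t a)` (the two arcs between the azimuths `t a`, `t b`
are at least `f a + f b`), and `f ≤ π` pointwise (only used when `S` is a singleton), then `Σ_S f ≤ π`: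
the walk from the least to the largest azimuth plus the wrap-around arc is `2π`. -/
theorem azimuth_weighted_budget {ι : Type*} [DecidableEq ι] (t f : ι → ℝ) (S : Finset ι)
    (hf : ∀ a ∈ S, f a ≤ π)
    (hgap : ∀ a ∈ S, ∀ b ∈ S, a ≠ b → t a ≤ t b →
      f a + f b ≤ t b - t a ∧ f a + f b ≤ 2 * π - (t b - t a)) :
    ∑ x ∈ S, f x ≤ π := by
  rcases S.eq_empty_or_nonempty with rfl | hS
  · rw [sum_empty]; exact pi_pos.le
  obtain ⟨lo, hlo, hi, hhi, h1, -, h3⟩ :=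
    azimuth_weighted_walk t f S (fun a ha b hb hab h => (hgap a ha b hb hab h).1) hS
  by_cases heq : lo = hi
  · subst heq
    have : ∑ x ∈ S, f x ≤ f lo := by linarith
    exact this.trans (hf lo hlo)
  · have hw := (hgap lo hlo hi hhi heq (h1 hi hhi)).2
    linarith

/-! ## 2. The pair lemma: `cos` minorants and two polynomial inequalities -/

/-- Chord of `cos` between `π/6` and `π/3` (concavity on `[−π/2, π/2]`): for `x ∈ [0, 1]`,
`cos (π/3 − (π/6) x) ≥ 1/2 + ((√3 − 1)/2) x`. -/
theorem cos_pi_div_three_sub_ge_chord {x : ℝ} (h0 : 0 ≤ x) (h1 : x ≤ 1) :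
    1 / 2 + (Real.sqrt 3 - 1) / 2 * x ≤ Real.cos (π / 3 - π / 6 * x) := by
  have hc := strictConcaveOn_cos_Icc.concaveOn.2
  have hm1 : π / 3 ∈ Set.Icc (-(π / 2)) (π / 2) := ⟨by linarith [pi_pos], by linarith [pi_pos]⟩
  have hm2 : π / 6 ∈ Set.Icc (-(π / 2)) (π / 2) := ⟨by linarith [pi_pos], by linarith [pi_pos]⟩
  have h := hc hm1 hm2 (a := 1 - x) (b := x) (by linarith) h0 (by ring)
  simp only [smul_eq_mul] at h
  rw [Real.cos_pi_div_three, Real.cos_pi_div_six] at h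
  have e : (1 - x) * (π / 3) + x * (π / 6) = π / 3 - π / 6 * x := by ring
  rw [e] at h
  linarith

/-- For `x ∈ [1, 2]` the angle `π/3 − (π/6) x` lies in `[0, π/6]`, so its cosine is `≥ √3/2`. -/
theorem cos_pi_div_three_sub_ge_sqrt_three_half {x : ℝ} (h1 : 1 ≤ x) (h2 : x ≤ 2) :
    Real.sqrt 3 / 2 ≤ Real.cos (π / 3 - π / 6 * x) := by
  rw [← Real.cos_pi_div_six]
  apply Real.cos_le_cos_of_nonneg_of_le_pi
  · nlinarith [pi_pos]
  · linarith [pi_pos]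
  · nlinarith [pi_pos]

/-- The polynomial inequality behind the chord case (`a + b ≤ 1`, heights `ca`, `cb`; `s = √3`):
`(3 − 4ab)² ≤ (3 − 2a²)(3 − 2b²)(1 + (s − 1)(a + b))²`.  The difference is
`3p(1−p)(6(s−1) + 4p + (8−4s)p²) + q(36 − 12q + 24(s−1)p + (48−24s)p² + 8(s−1)pq + (16−8s)p²q)` with
`p = a + b`, `q = ab` (using `s² = 3`), a sum of non-negative terms; equality at `(0,0)`, `(0,1)`, `(1,0)`. -/
theorem hollowPair_poly_chord {a b s : ℝ} (ha : 0 ≤ a) (hb : 0 ≤ b) (hab : a + b ≤ 1) (hs : s ^ 2 = 3)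
    (hs1 : 1 ≤ s) (hs2 : s ≤ 2) :
    (3 - 4 * a * b) ^ 2 ≤ (3 - 2 * a ^ 2) * (3 - 2 * b ^ 2) * (1 + (s - 1) * (a + b)) ^ 2 := by
  have key : (3 - 2 * a ^ 2) * (3 - 2 * b ^ 2) * (1 + (s - 1) * (a + b)) ^ 2 - (3 - 4 * a * b) ^ 2
      = 3 * (a + b) * (1 - (a + b)) * (6 * (s - 1) + 4 * (a + b) + (8 - 4 * s) * (a + b) ^ 2)
        + a * b * (36 - 12 * (a * b) + 24 * (s - 1) * (a + b) + (48 - 24 * s) * (a + b) ^ 2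
          + 8 * (s - 1) * (a + b) * (a * b) + (16 - 8 * s) * (a + b) ^ 2 * (a * b)) := by
    linear_combination ((3 - 2 * a ^ 2) * (3 - 2 * b ^ 2) * (a + b) ^ 2) * hs
  have hp0 : 0 ≤ a + b := by linarith
  have hq0 : 0 ≤ a * b := mul_nonneg ha hb
  have hq1 : a * b ≤ 1 := by nlinarith
  have t1 : 0 ≤ 3 * (a + b) * (1 - (a + b)) * (6 * (s - 1) + 4 * (a + b) + (8 - 4 * s) * (a + b) ^ 2) := by
    apply mul_nonneg (mul_nonneg (by linarith) (by linarith))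
    nlinarith [sq_nonneg (a + b)]
  have t2 : 0 ≤ a * b * (36 - 12 * (a * b) + 24 * (s - 1) * (a + b) + (48 - 24 * s) * (a + b) ^ 2
          + 8 * (s - 1) * (a + b) * (a * b) + (16 - 8 * s) * (a + b) ^ 2 * (a * b)) := by
    apply mul_nonneg hq0
    have h3 : 0 ≤ 24 * (s - 1) * (a + b) := by
      apply mul_nonneg (mul_nonneg (by norm_num) (by linarith)) hp0
    have h4 : 0 ≤ (48 - 24 * s) * (a + b) ^ 2 := mul_nonneg (by linarith) (sq_nonneg _)
    have h5 : 0 ≤ 8 * (s - 1) * (a + b) * (a * b) :=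
      mul_nonneg (mul_nonneg (mul_nonneg (by norm_num) (by linarith)) hp0) hq0
    have h6 : 0 ≤ (16 - 8 * s) * (a + b) ^ 2 * (a * b) :=
      mul_nonneg (mul_nonneg (by linarith) (sq_nonneg _)) hq0
    linarith
  linarith [key, t1, t2]

/-- The polynomial inequality behind the flat case (`a + b ≥ 1`): `(3 − 4ab)² ≤ 3(3 − 2a²)(3 − 2b²)` on
`[0,1]²`; the difference is `18(1 − p²) + 60q − 4q²` with `q ≥ p − 1`, `q ≤ 1`, `p ≤ 2`; equality at `(0,1)`,
`(1,0)`. -/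
theorem hollowPair_poly_flat {a b : ℝ} (ha : 0 ≤ a) (hb : 0 ≤ b) (ha1 : a ≤ 1) (hb1 : b ≤ 1) (hab : 1 ≤ a + b) :
    (3 - 4 * a * b) ^ 2 ≤ 3 * ((3 - 2 * a ^ 2) * (3 - 2 * b ^ 2)) := by
  have key : 3 * ((3 - 2 * a ^ 2) * (3 - 2 * b ^ 2)) - (3 - 4 * a * b) ^ 2
      = 18 * (1 - (a + b) ^ 2) + 60 * (a * b) - 4 * (a * b) ^ 2 := by ring
  have hq0 : 0 ≤ a * b := mul_nonneg ha hb
  have hq1 : a * b ≤ 1 := by nlinarith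
  have hqp : a + b - 1 ≤ a * b := by nlinarith [mul_nonneg (sub_nonneg.2 ha1) (sub_nonneg.2 hb1)]
  have hp2 : a + b ≤ 2 := by linarith
  have h1 : 56 * (a * b) ≤ 60 * (a * b) - 4 * (a * b) ^ 2 := by nlinarith
  have h2 : 0 ≤ (a + b - 1) * (38 - 18 * (a + b)) := mul_nonneg (by linarith) (by linarith)
  nlinarith [key, h1, h2, hqp]

/-- **The pair lemma in analytic form.**  For heights `ca, cb` with `a, b ∈ [0, 1]` (`c = √(2/3)`, so
`(ca)² = (2/3)a²`): `1/2 − (2/3)ab ≤ √(1 − (2/3)a²) · √(1 − (2/3)b²) · cos (π/3 − (π/6)(a + b))`, i.e.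
the largest cosine of an azimuth difference allowed by the `60°`-separation is at most `cos (ω + ω')`,
`ω = (π/6)(1 − a)`.  Equality at `(0,0)` (two equatorial vectors `60°` apart in azimuth) and at `(0,1)`,
`(1,0)` (an equatorial vector and one at height `c`, `30°` apart in azimuth). -/
theorem hollowPair_cos_bound {a b : ℝ} (ha : 0 ≤ a) (ha1 : a ≤ 1) (hb : 0 ≤ b) (hb1 : b ≤ 1) :
    1 / 2 - 2 / 3 * a * b ≤ Real.sqrt (1 - 2 / 3 * a ^ 2) * Real.sqrt (1 - 2 / 3 * b ^ 2) *
      Real.cos (π / 3 - π / 6 * (a + b)) := by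
  set s := Real.sqrt 3 with hs_def
  have hs : s ^ 2 = 3 := Real.sq_sqrt (by norm_num)
  have hs0 : 0 ≤ s := Real.sqrt_nonneg 3
  have hs1 : 1 ≤ s := by nlinarith
  have hs2 : s ≤ 2 := by nlinarith
  have hXp : 0 ≤ 1 - 2 / 3 * a ^ 2 := by nlinarith
  have hYp : 0 ≤ 1 - 2 / 3 * b ^ 2 := by nlinarith
  set X := Real.sqrt (1 - 2 / 3 * a ^ 2) with hX_def
  set Y := Real.sqrt (1 - 2 / 3 * b ^ 2) with hY_def
  have hX2 : X ^ 2 = 1 - 2 / 3 * a ^ 2 := Real.sq_sqrt hXp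
  have hY2 : Y ^ 2 = 1 - 2 / 3 * b ^ 2 := Real.sq_sqrt hYp
  have hX0 : 0 ≤ X := Real.sqrt_nonneg _
  have hY0 : 0 ≤ Y := Real.sqrt_nonneg _
  have hXY : 0 ≤ X * Y := mul_nonneg hX0 hY0
  by_cases hab : a + b ≤ 1
  · have hm := cos_pi_div_three_sub_ge_chord (x := a + b) (by linarith) hab
    have hm0 : 0 ≤ 1 / 2 + (s - 1) / 2 * (a + b) := by nlinarith
    have hL : 0 ≤ 1 / 2 - 2 / 3 * a * b := by nlinarith
    have step : 1 / 2 - 2 / 3 * a * b ≤ X * Y * (1 / 2 + (s - 1) / 2 * (a + b)) := by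
      rw [← pow_le_pow_iff_left₀ hL (mul_nonneg hXY hm0) two_ne_zero]
      have hA := hollowPair_poly_chord ha hb hab hs hs1 hs2
      calc (1 / 2 - 2 / 3 * a * b) ^ 2 = (3 - 4 * a * b) ^ 2 / 36 := by ring
        _ ≤ (3 - 2 * a ^ 2) * (3 - 2 * b ^ 2) * (1 + (s - 1) * (a + b)) ^ 2 / 36 := by gcongr
        _ = (X * Y * (1 / 2 + (s - 1) / 2 * (a + b))) ^ 2 := by rw [mul_pow, mul_pow, hX2, hY2]; ring
    exact step.trans (mul_le_mul_of_nonneg_left hm hXY)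
  · push Not at hab
    have hm := cos_pi_div_three_sub_ge_sqrt_three_half (x := a + b) hab.le (by linarith)
    have hcos0 : 0 ≤ Real.cos (π / 3 - π / 6 * (a + b)) := le_trans (by positivity) hm
    by_cases hL : 1 / 2 - 2 / 3 * a * b ≤ 0
    · exact hL.trans (mul_nonneg hXY hcos0)
    · push Not at hL
      have step : 1 / 2 - 2 / 3 * a * b ≤ X * Y * (s / 2) := by
        rw [← pow_le_pow_iff_left₀ hL.le (mul_nonneg hXY (by linarith)) two_ne_zero]
        have hA := hollowPair_poly_flat ha hb ha1 hb1 hab.le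
        calc (1 / 2 - 2 / 3 * a * b) ^ 2 = (3 - 4 * a * b) ^ 2 / 36 := by ring
          _ ≤ 3 * ((3 - 2 * a ^ 2) * (3 - 2 * b ^ 2)) / 36 := by gcongr
          _ = (X * Y * (s / 2)) ^ 2 := by rw [mul_pow, mul_pow, hX2, hY2, div_pow, hs]; ring
      exact step.trans (mul_le_mul_of_nonneg_left hm hXY)

end Summit.Ventures.Crystal3D.Theorems

end
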